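import Summits.QuantumFields.YangMills.Theorems.BalabanUVNodesN26AtBetaOfRecord11StepObjects
import Literature.MathematicalPhysics.QuantumFieldTheory.Balaban1983to89.Node00.Record12

/-!
# DAG node N26 — B4 «β-continuity» AT NODE 00's STAGE-12 RECORD `Node00.IsRecordOfRecord₁₂C` (def-T's `Node00/Record12.lean`, 12b):
# the node's literal at the β of record at Stage 12, `(datumOfRecord₁₂ F N θ h).βfun = betaOfRecord₁₀ θ.toStage9Params = betaOfRecord₁₁ (θ.toStage11 p)` (`rfl`),
# in residue ∕ chain ∕ socket currency BY NAME, the ∀-form `N26_B4lit (IsRecordOfRecord₁₂C …)`, the Stage-10 shadow, and «N26 closes WITH N25» at Stage 12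

Cell `pub-ymgap`, YM-PLAN Track A (HUMAN RULING D-0062), seat `pub-ymgap-dag-n26-c` (trigger (t3) of the seat's HANDOFF: def-T's `Record12`; director-ym LINE №81 (3):
«every ₁₁ module re-instantiates at the view `Stage12Params.toStage11 θ p`»).  Third Stage-keyed N26 companion after `…N26AtRecord11` (p449759, socket currency at ₁₁ —
VACUOUS at ₁₁ by def-T's located defect №2 `not_provisos₁₁`) and `…N26AtBetaOfRecord11(StepObjects)` (p456171 ∕ p457986: θ-keyed proviso-free faces, IMMUNE to that defect and
consumed here AT THE VIEW).  STATUS OF RECORD: N26 = binder B4 is DEPENDENT on (D4) and VACATED in the discharge form of record (closes WITH B3 = N25, NODE O); the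
(D4)-chain instance for Bałaban's objects is 0∕1.

WHAT STAGE 12 IS FOR N26.  `Stage12Params extends Stage9Params`; the Stage-12 datum's β IS Stage 10's: `(datumOfRecord₁₂ F N θ h).βfun = betaOfRecord₁₀ F N θ.toStage9Params`
(`Node00.βfun_datumOfRecord₁₂`, `rfl`) `= betaOfRecord₉c θ.toStage9Params = betaOfRecord₁₁ (θ.toStage11 F N p)` for EVERY run `p` (`rfl`: the view's Stage-9 part IS θ's), so
every θ-keyed face of p456171 ∕ p457986 applies at the view and every split of the datum's β IS `oneLoopSplitOfRecord₁₁ (θ.toStage11 p)` (`oneLoopSplit_unique`).  The flows are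
`genFlow (betaOfRecord₁₀ θ.toStage9Params)` — the Stage-10 datum's of `θ.toStage9Params` under `h.base` — so END transports ₁₂ ↔ ₁₀.  The Stage-12 provisos have NO all-runs
radii field (12b v2 (F1)) and a window-guarded `bg` ((F2)), so `IsRecordOfRecord₁₂C` is NOT refuted by the ₁₁ mechanism; its inhabitation is K0′ (`Record12Inhabited`), NOT claimed here.
* §0 bridges: `βfun_datumOfRecord₁₂_eq_betaOfRecord₉c` ∕ `_eq_betaOfRecord₁₁_view` ∕ `_eq_stage10` (rfl), `flow_toB12_datumOfRecord₁₂_eq_stage10`, `endpointExistence_datumOfRecord₁₂_iff_stage10`,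
  `betaContH_datumOfRecord₁₂_iff_stage10`, `betaContH_datumOfRecord₁₂_iff` (what B4 IS at ₁₂: per-`k` history-continuity of the merged β over `(TcOfRecord, chiFixed7 θ.ν)`),
  `oneLoopSplit_datumOfRecord₁₂_eq_view`, `β0_datumOfRecord₁₂_eq`.
* §1 N26 at the ₁₂ datum: `n26_datumOfRecord₁₂_of_atSlopeCont` (residue at ANY split of the datum's β), `n26_datumOfRecord₁₂_of_chainTFac190H` (chain + (C-pt)), `n26_datumOfRecord₁₂_of_exists_chainTFac190H_view` (p457986's exposed-kernel instance AT THE VIEW),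
  `n26_datumOfRecord₁₂` (socket currency, dag-n26-a's `n26lit_betaOfRecord₉c_of_localizedRep` BY NAME).
* §2 record level: `n26_of_isRecordOfRecord₁₂C_of_atSlopeCont`, the ∀-form `n26_B4lit_rec12C_of_atSlopeCont`.
* §3 the Stage-10 shadow: `exists_rec10C_βfun_eq_of_isRecordOfRecord₁₂C`, `exists_rec10C_sameFlows_of_isRecordOfRecord₁₂C` (NODE O P3's `SameFlowsRefines` shape: same flows ∧ β ∧ window),
  `s_N25_rec12C_of_rec10C`, `n26_B4lit_rec12C_of_rec10C`.
* §4 «N26 closes WITH N25» at ₁₂: `endpoint_and_n26_datumOfRecord₁₂_of_residue_atSlopeCont`, `…_of_isRecordOfRecord₁₂C_…`, `s_N25_and_n26_B4lit_rec12C_of_residue_atSlopeCont`.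

HONEST FRAMING.  Count-neutral bookkeeping by name for a VACATED binder; 0 `def`, 0 `sorry`, no estimate.  Every residue ∕ chain ∕ socket input is a located HYPOTHESIS of NODE O ∕
rows (D1), (D4) about the record's OWN merged term family — INSTANCE 0∕1; the zero-activity witness is NOT used.  The ∀-forms over `IsRecordOfRecord₁₂C` are NOT-A-DISCHARGE
(INHABITED-AT-₁₂C guard, K0′); N25 ∕ N26 NOT discharged; nothing of Bałaban's β asserted.  WATCH-N26-LIMIT-JUNK (dag-ref-D READ #106, inherited, NODE-O-side): the
merged β and `β⁰` of record are `limUnder` readings — where the (1.21) limit exists NOWHERE on a box they are history-constant and B4 holds BY JUNK; a B4 closer carries content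
only together with the EXISTENCE of the (1.21) limit on the box, which the socket's `hrep` ∕ the chain's `beta1_eq` supply — every theorem below is of that shape or weaker by design.  One finite four-torus programme at fixed ε per run — NOT the continuum limit, NOT ℝ⁴,
NOT infinite volume, NOT OS, NOT a mass gap, NOT Clay.
Sources (context): [I] = [Balaban1987RG1] CMP **109** (1987): Thm 2 p. 259, (0.13) p. 254, (1.7) p. 261, (1.20)–(1.22) p. 264, (2.12)–(2.13) p. 268, (5.10) p. 293; [II] =
[Balaban1988RG2Cluster] CMP **116** (1988): Lemma 3 (2.38) p. 20; [III] = [Balaban1988Convergent] CMP **119** (1988): (2.18) p. 257, (2.21) p. 258; [Balaban1989LargeFieldII]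
CMP **122** (1989): Thm 1 p. 355.
-/

noncomputable section

open scoped Matrix.Norms.L2Operator

namespace Summit.QuantumFields.YangMills.Theorems.BalabanUVNodesN26AtRecord12

open Literature.MathematicalPhysics.QuantumFieldTheory.Balaban1983to89
open Literature.MathematicalPhysics.QuantumFieldTheory.Balaban1983to89.FlowStep
open Literature.MathematicalPhysics.QuantumFieldTheory.Balaban1983to89.DagBinding (EndpointExistence WorldP)
open Literature.MathematicalPhysics.QuantumFieldTheory.Balaban1983to89.T4Continuum (T4Family FiniteEpsData)
open Literature.MathematicalPhysics.QuantumFieldTheory.Balaban1983to89.Node00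
open Literature.MathematicalPhysics.QuantumFieldTheory.Balaban1983to89.B13ScaleTransfer (Pt)
open Literature.MathematicalPhysics.QuantumFieldTheory.Balaban1983to89.Beta.RemainderChainLattice
open Literature.MathematicalPhysics.QuantumFieldTheory.Balaban1983to89.Beta.RemainderLimitTorus (LDom limKernel)
open Literature.MathematicalPhysics.QuantumFieldTheory.Balaban1983to89.Beta.RemainderDecay190
open Literature.MathematicalPhysics.QuantumFieldTheory.Balaban1983to89.Beta.RemainderLocalityHolo (PolLeavesTFac190H)
open Literature.MathematicalPhysics.QuantumFieldTheory.Balaban1983to89.Beta.RemainderDecay190HoloChain (ChainTFac190H)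
open Literature.MathematicalPhysics.QuantumFieldTheory.Balaban1983to89.Beta.OneStepKernelFamily (TbalOf)
open Literature.MathematicalPhysics.QuantumFieldTheory.Balaban1983to89.Beta.OneStepResolventKernel (JetData)
open Summit.QuantumFields.BalabanUV.Gaps
open Summit.QuantumFields.BalabanUV.Gaps.BetaContFromD4Chain
open Summit.QuantumFields.YangMills.Theorems.BalabanUVNodesN26AtBetaC (betaContH_betaOfRecord₉c_iff n26lit_betaOfRecord₉c_of_localizedRep)
open Summit.QuantumFields.YangMills.Theorems.BalabanUVNodesN26AtRecord9 (endpointExistence_congr n26_B4lit_of_betaShadow)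
open Summit.QuantumFields.YangMills.BalabanUVNodes.N28AtBetaOfRecord (oneLoopSplit_unique)
open Summit.QuantumFields.YangMills.Theorems.BalabanUVNodesN26AtBetaOfRecord11StepObjects (betaContH_betaOfRecord₁₁_of_exists_chainTFac190H)
open Filter Topology

/-! ## §0 Bridges: the Stage-12 datum has Stage 10's β and flows; what B4 and the split ARE at ₁₂ -/

section Bridges

variable (F : T4Family) (N : ℕ) [NeZero N]

/-- **THE β OF RECORD AT STAGE 12 IS `betaOfRecord₉c`** of the Stage-9 part (`Node00.βfun_datumOfRecord₁₂`, `rfl`). [cite: Balaban1987RG1, (1.20)-(1.22) p.264 (bookkeeping)] -/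
theorem βfun_datumOfRecord₁₂_eq_betaOfRecord₉c (θ : Stage12Params F N) (h : θ.Provisos₁₂ F N) :
    (datumOfRecord₁₂ F N θ h).βfun = betaOfRecord₉c F N θ.toStage9Params := rfl

/-- **… and IS def-B's `betaOfRecord₁₁` AT THE STAGE-11 VIEW of every run** (`rfl`: the view's Stage-9 part IS θ's), so every θ-keyed face of `Record11Beta` ∕
`…N26AtBetaOfRecord11(StepObjects)` applies at `θ.toStage11 F N p`. [cite: Balaban1987RG1, (1.20)-(1.22) p.264 (bookkeeping)] -/
theorem βfun_datumOfRecord₁₂_eq_betaOfRecord₁₁_view (θ : Stage12Params F N) (h : θ.Provisos₁₂ F N) (p : B12.RunParams) :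
    (datumOfRecord₁₂ F N θ h).βfun = betaOfRecord₁₁ F N (θ.toStage11 F N p) := rfl

/-- **… and IS the Stage-10 datum's β** of `θ.toStage9Params` under the inherited provisos `h.base` (`rfl`). [cite: Balaban1987RG1, (1.20)-(1.22) p.264 (bookkeeping)] -/
theorem βfun_datumOfRecord₁₂_eq_stage10 (θ : Stage12Params F N) (h : θ.Provisos₁₂ F N) :
    (datumOfRecord₁₂ F N θ h).βfun = (datumOfRecord₁₀ F N θ.toStage9Params h.base).βfun := rfl

/-- **The Stage-12 datum's runs have THE SAME FLOWS as the Stage-10 datum's of `θ.toStage9Params`** (both `genFlow (betaOfRecord₁₀ θ.toStage9Params)`; the Stage-12 core IS the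
Stage-10 core with the §2 clause re-pinned). [cite: Balaban1987RG1, (0.17)-(0.20) pp.255-256 (bookkeeping)] -/
theorem flow_toB12_datumOfRecord₁₂_eq_stage10 (θ : Stage12Params F N) (h : θ.Provisos₁₂ F N) (P : B12.RunParams) :
    ((datumOfRecord₁₂ F N θ h).C.toB12 P).flow = ((datumOfRecord₁₀ F N θ.toStage9Params h.base).C.toB12 P).flow := by
  show ((datumOfRecord₁₂ F N θ h).C P).flow = ((datumOfRecord₁₀ F N θ.toStage9Params h.base).C P).flow
  rw [flow_datumOfRecord₁₀]
  rfl

/-- **N25's END AT THE STAGE-12 DATUM ↔ AT THE STAGE-10 DATUM of `θ.toStage9Params`** (same flows; `endpointExistence_congr`). [cite: Balaban1987RG1, Thm 2 p.259 (first sentence; bookkeeping)] -/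
theorem endpointExistence_datumOfRecord₁₂_iff_stage10 (θ : Stage12Params F N) (h : θ.Provisos₁₂ F N) :
    EndpointExistence (datumOfRecord₁₂ F N θ h).C.toB12 ↔ EndpointExistence (datumOfRecord₁₀ F N θ.toStage9Params h.base).C.toB12 :=
  endpointExistence_congr (flow_toB12_datumOfRecord₁₂_eq_stage10 F N θ h)

/-- **B4 on a box `γc` AT THE STAGE-12 DATUM ↔ AT THE STAGE-10 DATUM** (same `βfun`; `Iff.rfl`). [cite: Balaban1987RG1, (1.20)-(1.22) p.264 (bookkeeping)] -/
theorem betaContH_datumOfRecord₁₂_iff_stage10 (θ : Stage12Params F N) (h : θ.Provisos₁₂ F N) (γc : ℝ) :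
    BetaContH γc (datumOfRecord₁₂ F N θ h).βfun ↔ BetaContH γc (datumOfRecord₁₀ F N θ.toStage9Params h.base).βfun :=
  Iff.rfl

/-- **WHAT B4 IS AT THE STAGE-12 DATUM**: on a box `γc ≤ θ.γ`, per-`k` history-continuity on `]0,γc]^{k+1}` of the MERGED β over `(TcOfRecord, chiFixed7 θ.ν)`
(dag-n26-a's `betaContH_betaOfRecord₉c_iff` BY NAME at the Stage-9 part). [cite: Balaban1987RG1, (0.13) p.254 and (1.20)-(1.22) p.264] -/
theorem betaContH_datumOfRecord₁₂_iff (θ : Stage12Params F N) (h : θ.Provisos₁₂ F N) {γc : ℝ} (hle : γc ≤ θ.γ) :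
    BetaContH γc (datumOfRecord₁₂ F N θ h).βfun ↔
      letI := θ.instVβ₁; letI := θ.instVβ₂; letI := θ.instιβ
      ∀ k, ContinuousOn
        (betaMerged F (mergedTermFamilyMatT F N (TcOfRecord F N) (chiFixed7 F N θ.ν) θ.εbg) θ.ρ8 θ.bV k) (Box γc k) :=
  betaContH_betaOfRecord₉c_iff F N θ.toStage9Params hle

/-- **EVERY SPLIT OF THE STAGE-12 DATUM's β IS def-B's `oneLoopSplitOfRecord₁₁` AT THE VIEW** (any run; `oneLoopSplit_unique`). [cite: Balaban1987RG1, (2.12)-(2.14) p.268] -/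
theorem oneLoopSplit_datumOfRecord₁₂_eq_view (θ : Stage12Params F N) (h : θ.Provisos₁₂ F N) (p : B12.RunParams)
    (Sβ : B12Beta.OneLoopSplit (datumOfRecord₁₂ F N θ h).βfun) : Sβ = oneLoopSplitOfRecord₁₁ F N (θ.toStage11 F N p) :=
  oneLoopSplit_unique _ _

/-- … so its one-loop field IS the one-loop number of record `beta0OfRecord₁₁ (θ.toStage11 p) = beta0OfMerged (β_merged) θ.v₀` (what every NODE-O pin speaks about).
[cite: Balaban1987RG1, (2.12)-(2.14) p.268] -/
theorem β0_datumOfRecord₁₂_eq (θ : Stage12Params F N) (h : θ.Provisos₁₂ F N) (p : B12.RunParams)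
    (Sβ : B12Beta.OneLoopSplit (datumOfRecord₁₂ F N θ h).βfun) : Sβ.β0 = beta0OfRecord₁₁ F N (θ.toStage11 F N p) := by
  have hS := oneLoopSplit_datumOfRecord₁₂_eq_view F N θ h p Sβ
  subst hS
  rfl

end Bridges

/-! ## §1 N26 at the Stage-12 datum in residue ∕ chain ∕ socket currency -/

section AtDatum

variable (F : T4Family) (N : ℕ) [NeZero N]

/-- **N26 AT THE STAGE-12 DATUM FROM THE ROWS-(D4) ∧ B4 RESIDUE** at ANY split of the datum's β (= the record's split at every view, §0) on a box `0 < γ₀`, any slope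
(`Gaps.BetaContFromD4Chain.betaContH_of_atSlopeCont`).  A located hypothesis of NODE O; instance 0∕1. [cite: Balaban1988RG2Cluster, Lemma 3 (2.38) p.20; Balaban1987RG1, (1.20)-(1.22) p.264 and (5.10) p.293] -/
theorem n26_datumOfRecord₁₂_of_atSlopeCont (θ : Stage12Params F N) (hP : θ.Provisos₁₂ F N) {γ₀ : ℝ} (hγ₀ : 0 < γ₀)
    {Sβ : B12Beta.OneLoopSplit (datumOfRecord₁₂ F N θ hP).βfun} {s : ℝ} (h : AtSlopeCont Sβ γ₀ s) :
    ∃ γc : ℝ, 0 < γc ∧ BetaContH γc (datumOfRecord₁₂ F N θ hP).βfun :=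
  ⟨γ₀, hγ₀, betaContH_of_atSlopeCont h⟩

/-- **N26 AT THE STAGE-12 DATUM FROM THE (D4)-CHAIN INSTANCE + (C-pt)** (any split, holomorphic currency; `betaContH_of_chainTFac190H`).  THIS inhabitant is what NODE O ∕ row (D4)
owe for Bałaban's construction: instance 0∕1. [cite: Balaban1987RG1, (1.7) p.261, (1.20)-(1.22) p.264 and (5.10) p.293; Balaban1988RG2Cluster, Lemma 3 (2.38) p.20] -/
theorem n26_datumOfRecord₁₂_of_chainTFac190H (θ : Stage12Params F N) (hP : θ.Provisos₁₂ F N) {M : ℕ} [NeZero M] {μ ν : Fin 4}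
    (Sβ : B12Beta.OneLoopSplit (datumOfRecord₁₂ F N θ hP).βfun) {γ₀ : ℝ} (hγ₀ : 0 < γ₀) {c : B13.Consts} {ℓ α₂ : ℝ} {q : Consts190}
    (R : ChainTFac190H 4 M μ ν Sβ γ₀ c ℓ α₂ q) (hC : CondsL 4 c ℓ) (h22 : c.R22gen ℓ) (hq : q.Valid c.δ₀) (hs : SignsL c α₂ q.B₃) (hcont : CPt R) :
    ∃ γc : ℝ, 0 < γc ∧ BetaContH γc (datumOfRecord₁₂ F N θ hP).βfun :=
  ⟨γ₀, hγ₀, betaContH_of_chainTFac190H R hC h22 hq hs (by norm_num) hcont⟩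

/-- **N26 AT THE STAGE-12 DATUM FROM AN EXPOSED-KERNEL INSTANCE AT THE VIEW** — the re-instantiation mechanism of director LINE №81 (3) made concrete: the (D4)-chain instance
at def-B's `oneLoopSplitOfRecord₁₁ (θ.toStage11 F N p)` (any run `p`; e.g. BUILT from the crew's step objects by p457986's
`exists_chainTFac190H_oneLoopSplitOfRecord₁₁_of_stepObjects` at the view) with exposed leaf kernels `A1`, N1–N3 and (C-pt) on `A1` ⟹ the literal at the ₁₂ datum
(p457986's θ-keyed `betaContH_betaOfRecord₁₁_of_exists_chainTFac190H` at the view; the β agrees by `rfl`, §0). Instance 0∕1.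
[cite: Balaban1987RG1, (1.7) p.261, (1.20)-(1.22) p.264 and (5.10) p.293; Balaban1988RG2Cluster, Lemma 3 (2.38) p.20] -/
theorem n26_datumOfRecord₁₂_of_exists_chainTFac190H_view (θ : Stage12Params F N) (hP : θ.Provisos₁₂ F N) (p : B12.RunParams) {M : ℕ} [NeZero M]
    {μ ν : Fin 4} {γ₀ : ℝ} (hγ₀ : 0 < γ₀) {c : B13.Consts} {ℓ α₂ : ℝ} {q : Consts190} {A1 : (k : ℕ) → (Fin (k + 1) → ℝ) → LDom 4 → Pt 4 → ℝ}
    (h : ∃ R : ChainTFac190H 4 M μ ν (oneLoopSplitOfRecord₁₁ F N (θ.toStage11 F N p)) γ₀ c ℓ α₂ q, R.A1 = A1)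
    (hC : CondsL 4 c ℓ) (h22 : c.R22gen ℓ) (hq : q.Valid c.δ₀) (hs : SignsL c α₂ q.B₃)
    (hcpt : ∀ k (x : Pt 4), ContinuousOn (fun v : Fin (k + 1) → ℝ => limKernel (A1 k v) x) (Box γ₀ k)) :
    ∃ γc : ℝ, 0 < γc ∧ BetaContH γc (datumOfRecord₁₂ F N θ hP).βfun :=
  ⟨γ₀, hγ₀, betaContH_betaOfRecord₁₁_of_exists_chainTFac190H F N (θ.toStage11 F N p) h hC h22 hq hs hcpt⟩

/-- **N26 AT THE STAGE-12 DATUM FROM THE (D4) SOCKET INPUTS** for θ's own merged term family over `(TcOfRecord, chiFixed7 θ.ν)` on a box `0 < γ₀ ≤ θ.γ` (dag-n26-a's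
`n26lit_betaOfRecord₉c_of_localizedRep` BY NAME at the Stage-9 part).  Every input a located hypothesis of NODE O; instance 0∕1.
[cite: Balaban1987RG1, (0.13) p.254, (1.7) p.261, (1.20)-(1.22) p.264 and (5.10) p.293; Balaban1988RG2Cluster, Lemma 3 (2.38) p.20] -/
theorem n26_datumOfRecord₁₂ (θ : Stage12Params F N) (hP : θ.Provisos₁₂ F N) {γ₀ : ℝ} (hγ₀ : 0 < γ₀) (hle : γ₀ ≤ θ.γ) {M : ℕ} [NeZero M]
    {c : B13.Consts} {ℓ α₂ : ℝ} {q : Consts190} (P0 : ℕ → Pt 4 → ℝ)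
    (hβ0 : letI := θ.instVβ₁; letI := θ.instVβ₂; letI := θ.instιβ
      ∀ k, beta0OfMerged (betaMerged F (mergedTermFamilyMatT F N (TcOfRecord F N) (chiFixed7 F N θ.ν) θ.εbg) θ.ρ8 θ.bV) θ.v₀ k =
        B12Beta.secondMoment (fun _ _ => P0 k) 0 1)
    (hP0 : ∀ k, ∃ C δ₁ : ℝ, 0 < δ₁ ∧ B12Sec2to5.Decay510 (P0 k) C δ₁)
    (A1 : (k : ℕ) → (Fin (k + 1) → ℝ) → LDom 4 → Pt 4 → ℝ)
    (hrep : letI := θ.instVβ₁; letI := θ.instVβ₂; letI := θ.instιβ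
      ∀ k (p : Fin (k + 1) → ℝ), p ∈ Box γ₀ k → ∀ z : Pt 4,
        polLimit F (k + 1) (fun K => mergedTermFamilyMatT F N (TcOfRecord F N) (chiFixed7 F N θ.ν) θ.εbg k p K) θ.ρ8 θ.bV 0 1 z =
          P0 k z + limKernel (A1 k p) z)
    (hleaves : ∀ k (p : Fin (k + 1) → ℝ), p ∈ Box γ₀ k → PolLeavesTFac190H 4 M (A1 k p) c ℓ α₂ q)
    (hC : CondsL 4 c ℓ) (h22 : c.R22gen ℓ) (hq : q.Valid c.δ₀) (hs : SignsL c α₂ q.B₃)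
    (hcont : letI := θ.instVβ₁; letI := θ.instVβ₂; letI := θ.instιβ
      ∀ k (z : Pt 4), ContinuousOn (fun p : Fin (k + 1) → ℝ =>
        polLimit F (k + 1) (fun K => mergedTermFamilyMatT F N (TcOfRecord F N) (chiFixed7 F N θ.ν) θ.εbg k p K) θ.ρ8 θ.bV 0 1 z) (Box γ₀ k)) :
    ∃ γc : ℝ, 0 < γc ∧ BetaContH γc (datumOfRecord₁₂ F N θ hP).βfun := by
  rw [βfun_datumOfRecord₁₂_eq_betaOfRecord₉c]
  exact n26lit_betaOfRecord₉c_of_localizedRep F N θ.toStage9Params hγ₀ hle P0 hβ0 hP0 A1 hrep hleaves hC h22 hq hs hcont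

end AtDatum

/-! ## §2 Record level, residue currency: N26 at a Stage-12 record and the ∀-form -/

section Route

variable (F : T4Family) (N : ℕ) [NeZero N]

/-- **N26 AT A STAGE-12 RECORD `(D, w)` FROM THE RESIDUE ON THE WORLD'S OWN WINDOW**: if every admissible presentation `θ` (with provisos) of `D` with `w.γ ≤ θ.γ` carries, at
SOME split of `D`'s β and SOME slope, `AtSlopeCont Sβ w.γ s`, then `∃ γc > 0, BetaContH γc D.βfun` (`γc := w.γ`).  Instance 0∕1; N26 NOT discharged.
[cite: Balaban1987RG1, (1.20)-(1.22) p.264; Balaban1988RG2Cluster, Lemma 3 (2.38) p.20; Balaban1989LargeFieldII, Thm 1 p.355 (the record)] -/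
theorem n26_of_isRecordOfRecord₁₂C_of_atSlopeCont {D : FiniteEpsData F (Matrix.specialUnitaryGroup (Fin N) ℂ)} {w : WorldP}
    (h : IsRecordOfRecord₁₂C F N D w)
    (hin : ∀ (θ : Stage12Params F N) (hP : θ.Provisos₁₂ F N), θ.Admissible F N → D = datumOfRecord₁₂ F N θ hP → w.γ ≤ θ.γ →
      ∃ (Sβ : B12Beta.OneLoopSplit D.βfun) (s : ℝ), AtSlopeCont Sβ w.γ s) :
    ∃ γc : ℝ, 0 < γc ∧ BetaContH γc D.βfun := by
  obtain ⟨θ, hP, hθ, hD, -, ⟨hγ0, hγle⟩, -, -⟩ := h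
  obtain ⟨Sβ, s, hs⟩ := hin θ hP hθ hD hγle
  exact ⟨w.γ, hγ0, betaContH_of_atSlopeCont hs⟩

variable {F N} in
/-- **`N26_B4lit` AT `Rec := IsRecordOfRecord₁₂C`, RESIDUE CURRENCY — the ∀-form of record at Stage 12.**  NOT-A-DISCHARGE (INHABITED-AT-₁₂C guard, K0′); instance 0∕1.
[cite: Balaban1987RG1, (1.20)-(1.22) p.264; Balaban1988RG2Cluster, Lemma 3 (2.38) p.20] -/
theorem n26_B4lit_rec12C_of_atSlopeCont
    (hin : ∀ (F : T4Family) (D : FiniteEpsData F (Matrix.specialUnitaryGroup (Fin N) ℂ)) (w : WorldP)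
      (θ : Stage12Params F N) (hP : θ.Provisos₁₂ F N), θ.Admissible F N → D = datumOfRecord₁₂ F N θ hP → w.γ ≤ θ.γ →
      ∃ (Sβ : B12Beta.OneLoopSplit D.βfun) (s : ℝ), AtSlopeCont Sβ w.γ s) :
    YMDAG.UVSplit.N26_B4lit (fun F D w => IsRecordOfRecord₁₂C F N D w) :=
  fun F D w h => n26_of_isRecordOfRecord₁₂C_of_atSlopeCont F N h (hin F D w)

end Route

/-! ## §3 The Stage-10 shadow -/

section Shadow

variable (F : T4Family) (N : ℕ) [NeZero N]

/-- **EVERY STAGE-12 RECORD HAS A STAGE-10 RECORD WITH THE SAME β-FUNCTIONS AND THE SAME WINDOW**: the Stage-10 datum of `θ.toStage9Params` under `h.base`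
(`Stage12Params.Admissible.toStage9`) at a FRESH world of window `w.γ` (`Node00.exists_world_isRecordOfRecord₁₀C`). [cite: Balaban1989LargeFieldII, Thm 1 + (0.1) pp.355-356; Balaban1987RG1, (1.20)-(1.22) p.264 (bookkeeping)] -/
theorem exists_rec10C_βfun_eq_of_isRecordOfRecord₁₂C {D : FiniteEpsData F (Matrix.specialUnitaryGroup (Fin N) ℂ)} {w : WorldP}
    (h : IsRecordOfRecord₁₂C F N D w) :
    ∃ (D' : FiniteEpsData F (Matrix.specialUnitaryGroup (Fin N) ℂ)) (w' : WorldP),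
      IsRecordOfRecord₁₀C F N D' w' ∧ D'.βfun = D.βfun ∧ w'.γ = w.γ := by
  obtain ⟨θ, hP, hθ, hD, -, hγ, -, -⟩ := h
  obtain ⟨w', hw', hγ'⟩ := exists_world_isRecordOfRecord₁₀C F N θ.toStage9Params hP.base hθ.toStage9 hγ
  subst hD
  exact ⟨_, w', hw', (βfun_datumOfRecord₁₂_eq_stage10 F N θ hP).symm, hγ'⟩

/-- **… WITH THE SAME FLOWS AS WELL** (NODE O P3's `SameFlowsRefines (Rec10) (Rec12)` shape, pub-ymgap INBOX l.12975): the Stage-10 shadow record of a Stage-12 record has, run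
by run, the same coupling flows (`flow_toB12_datumOfRecord₁₂_eq_stage10`), the same β-functions and the same window — so BOTH N25's END and N26's B4 transport ₁₀C → ₁₂C.
[cite: Balaban1989LargeFieldII, Thm 1 + (0.1) pp.355-356; Balaban1987RG1, Thm 2 p.259 and (1.20)-(1.22) p.264 (bookkeeping)] -/
theorem exists_rec10C_sameFlows_of_isRecordOfRecord₁₂C {D : FiniteEpsData F (Matrix.specialUnitaryGroup (Fin N) ℂ)} {w : WorldP}
    (h : IsRecordOfRecord₁₂C F N D w) :
    ∃ (D' : FiniteEpsData F (Matrix.specialUnitaryGroup (Fin N) ℂ)) (w' : WorldP),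
      IsRecordOfRecord₁₀C F N D' w' ∧ (∀ P, (D'.C.toB12 P).flow = (D.C.toB12 P).flow) ∧ D'.βfun = D.βfun ∧ w'.γ = w.γ := by
  obtain ⟨θ, hP, hθ, hD, -, hγ, -, -⟩ := h
  obtain ⟨w', hw', hγ'⟩ := exists_world_isRecordOfRecord₁₀C F N θ.toStage9Params hP.base hθ.toStage9 hγ
  subst hD
  exact ⟨_, w', hw', fun P => (flow_toB12_datumOfRecord₁₂_eq_stage10 F N θ hP P).symm, (βfun_datumOfRecord₁₂_eq_stage10 F N θ hP).symm, hγ'⟩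

variable {F N}

/-- **N25's ∀-form transports ₁₀C → ₁₂C** (same flows at the shadow; `endpointExistence_congr`) — the END half of «N26 closes WITH N25» follows the shadow too.
[cite: Balaban1987RG1, Thm 2 p.259 (first sentence; bookkeeping)] -/
theorem s_N25_rec12C_of_rec10C (h : YMDAG.UVSplit.S_N25 (fun F D w => IsRecordOfRecord₁₀C F N D w)) :
    YMDAG.UVSplit.S_N25 (fun F D w => IsRecordOfRecord₁₂C F N D w) := fun F D w hw => by
  obtain ⟨D', w', h', hflow, -, -⟩ := exists_rec10C_sameFlows_of_isRecordOfRecord₁₂C F N hw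
  exact (endpointExistence_congr (C := D'.C.toB12) (C' := D.C.toB12) hflow).mp (h F D' w' h')

/-- **WHOEVER CLOSES THE STAGE-10 ∀-FORM CLOSES THE STAGE-12 ONE** (β-shadow; dag-n26-a's `n26_B4lit_of_betaShadow` BY NAME). [cite: Balaban1987RG1, (1.22) p.264 (bookkeeping)] -/
theorem n26_B4lit_rec12C_of_rec10C (h : YMDAG.UVSplit.N26_B4lit (fun F D w => IsRecordOfRecord₁₀C F N D w)) :
    YMDAG.UVSplit.N26_B4lit (fun F D w => IsRecordOfRecord₁₂C F N D w) :=
  n26_B4lit_of_betaShadow (fun F _ _ hw => by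
    obtain ⟨D', w', h', hβ, -⟩ := exists_rec10C_βfun_eq_of_isRecordOfRecord₁₂C F N hw
    exact ⟨D', w', h', hβ⟩) h

end Shadow

/-! ## §4 «N26 closes WITH N25» at Stage 12, in the two named β-side predicates -/

section WithN25

variable (F : T4Family) (N : ℕ) [NeZero N]

/-- **N25's END ∧ N26 AT THE STAGE-12 DATUM**: row (D1)'s residue `Gaps.D1Residue.Residue Lc Js Nc μ ν` pinned on the one-loop field of a split `Sβ` of the datum's β (= the
one-loop number of record, §0), and the rows-(D4) ∧ B4 residue `AtSlopeCont Sβ γ₀ (stepBal Nc Lc)` on a box `0 < γ₀` ⟹ `EndpointExistence D.C.toB12 ∧ ∃ γc > 0, BetaContH γc D.βfun`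
(`Gaps.BetaContFromD4Chain.endpointExistence_of_residue_atSlopeCont` at the datum's own `fwd`).  Instance 0∕1 on both predicates; N25 ∕ N26 NOT discharged.
[cite: Balaban1987RG1, Thm 2 p.259 (first sentence), (1.20)-(1.22) p.264 and (2.12)-(2.14) p.268; Balaban1988RG2Cluster, Lemma 3 (2.38) p.20] -/
theorem endpoint_and_n26_datumOfRecord₁₂_of_residue_atSlopeCont (θ : Stage12Params F N) (hP : θ.Provisos₁₂ F N)
    (Sβ : B12Beta.OneLoopSplit (datumOfRecord₁₂ F N θ hP).βfun) {Lc : ℕ} [NeZero Lc] (Js : ℕ → JetData 3 Lc) {Nc : ℝ} {μ ν : Fin 4}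
    (hβ : ∀ j, Sβ.β0 j = B12Beta.secondMoment (TbalOf Lc Js j) μ ν) (h1 : D1Residue.Residue Lc Js Nc μ ν) {γ₀ : ℝ} (hγ₀ : 0 < γ₀)
    (hres : AtSlopeCont Sβ γ₀ (B12Normalization.stepBal Nc Lc)) :
    EndpointExistence (datumOfRecord₁₂ F N θ hP).C.toB12 ∧ ∃ γc : ℝ, 0 < γc ∧ BetaContH γc (datumOfRecord₁₂ F N θ hP).βfun :=
  ⟨endpointExistence_of_residue_atSlopeCont (datumOfRecord₁₂ F N θ hP).fwd Sβ Js hβ h1 hγ₀ hres, γ₀, hγ₀, betaContH_of_atSlopeCont hres⟩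

/-- **N25's END ∧ N26 AT A STAGE-12 RECORD `(D, w)`, predicate form, residue currency** (the package per admissible presentation, on the world's window, at the
one-loop slope). Instance 0∕1; N25 ∕ N26 NOT discharged. [cite: Balaban1987RG1, Thm 2 p.259 (first sentence) and (1.20)-(1.22) p.264; Balaban1988RG2Cluster, Lemma 3 (2.38) p.20] -/
theorem endpoint_and_n26_of_isRecordOfRecord₁₂C_of_residue_atSlopeCont {D : FiniteEpsData F (Matrix.specialUnitaryGroup (Fin N) ℂ)} {w : WorldP}
    (h : IsRecordOfRecord₁₂C F N D w)
    (hin : ∀ (θ : Stage12Params F N) (hP : θ.Provisos₁₂ F N), θ.Admissible F N → D = datumOfRecord₁₂ F N θ hP → w.γ ≤ θ.γ →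
      ∃ (Sβ : B12Beta.OneLoopSplit D.βfun) (Lc : ℕ) (_ : NeZero Lc) (Js : ℕ → JetData 3 Lc) (Nc : ℝ) (μ ν : Fin 4),
        (∀ j, Sβ.β0 j = B12Beta.secondMoment (TbalOf Lc Js j) μ ν) ∧ D1Residue.Residue Lc Js Nc μ ν ∧
        AtSlopeCont Sβ w.γ (B12Normalization.stepBal Nc Lc)) :
    EndpointExistence D.C.toB12 ∧ ∃ γc : ℝ, 0 < γc ∧ BetaContH γc D.βfun := by
  obtain ⟨θ, hP, hθ, hD, -, ⟨hγ0, hγle⟩, -, -⟩ := h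
  obtain ⟨Sβ, Lc, _, Js, Nc, μ, ν, hβ, h1, hres⟩ := hin θ hP hθ hD hγle
  subst hD
  exact endpoint_and_n26_datumOfRecord₁₂_of_residue_atSlopeCont F N θ hP Sβ Js hβ h1 hγ0 hres

variable {F N} in
/-- **«N26 CLOSES WITH N25» AT `Rec := IsRecordOfRecord₁₂C`, RESIDUE CURRENCY**: the route literals `YMDAG.UVSplit.S_N25 Rec ∧ YMDAG.UVSplit.N26_B4lit Rec` from ONE residue package per
presentation — the β-side shape of the restated crux K2′ over `IsRecordOfRecord₁₂C F 2`.  ∀-forms, NOT-A-DISCHARGE (INHABITED-AT-₁₂C guard); N25 ∕ N26 NOT discharged.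
[cite: Balaban1987RG1, Thm 2 p.259 (first sentence) and (1.20)-(1.22) p.264; Balaban1988RG2Cluster, Lemma 3 (2.38) p.20] -/
theorem s_N25_and_n26_B4lit_rec12C_of_residue_atSlopeCont
    (hin : ∀ (F : T4Family) (D : FiniteEpsData F (Matrix.specialUnitaryGroup (Fin N) ℂ)) (w : WorldP)
      (θ : Stage12Params F N) (hP : θ.Provisos₁₂ F N), θ.Admissible F N → D = datumOfRecord₁₂ F N θ hP → w.γ ≤ θ.γ →
      ∃ (Sβ : B12Beta.OneLoopSplit D.βfun) (Lc : ℕ) (_ : NeZero Lc) (Js : ℕ → JetData 3 Lc) (Nc : ℝ) (μ ν : Fin 4),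
        (∀ j, Sβ.β0 j = B12Beta.secondMoment (TbalOf Lc Js j) μ ν) ∧ D1Residue.Residue Lc Js Nc μ ν ∧
        AtSlopeCont Sβ w.γ (B12Normalization.stepBal Nc Lc)) :
    YMDAG.UVSplit.S_N25 (fun F D w => IsRecordOfRecord₁₂C F N D w) ∧
      YMDAG.UVSplit.N26_B4lit (fun F D w => IsRecordOfRecord₁₂C F N D w) :=
  ⟨fun F D w h => (endpoint_and_n26_of_isRecordOfRecord₁₂C_of_residue_atSlopeCont F N h (hin F D w)).1,
    fun F D w h => (endpoint_and_n26_of_isRecordOfRecord₁₂C_of_residue_atSlopeCont F N h (hin F D w)).2⟩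

end WithN25

end Summit.QuantumFields.YangMills.Theorems.BalabanUVNodesN26AtRecord12

end
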